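import Summits.CriticalPhenomena.Ising3DConformalLimit.Theses.CoerciveSharpness
import Summits.CriticalPhenomena.Ising3DConformalLimit.Theorems.PlantedPinningMoebiusLimitExistsTwoLeaf
import Summits.CriticalPhenomena.Ising3DConformalLimit.Theorems.CoerciveSharpnessMoebiusLimitSplit
import HarnessLib

/-!
# Glue of the registered split of crux `CoerciveSharpness.MoebiusLimit` (item stmt-CriticalPhenomena-1344)

The route file `Theses/CoerciveSharpness.lean` (rev 2) carries the glued split (gen 1) of the imported complement
`MoebiusLimit` into the two children

* `CoerciveSharpness.ExistsScaleCovariantLimit` — item stmt-CriticalPhenomena-1981 verbatim (existence of a normalised,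
  non-degenerate, translation-invariant, scale-covariant pointwise scaling limit of `criticalCorr 3`), and
* `CoerciveSharpness.InversionUpgradeNormalised` — item stmt-CriticalPhenomena-1982 verbatim (the inversion upgrade),

with the glue item `CoerciveSharpness.MoebiusLimitOfSubs : ExistsScaleCovariantLimit → InversionUpgradeNormalised → MoebiusLimit`
(item stmt-CriticalPhenomena-19104). This file proves the glue item BY NAME (pure composition with the landed two-leaf
factorisation `MoebiusLimitExistsTwoLeaf.coerciveSharpness_MoebiusLimit_of_leaves`, p142965), records that the two children are
the shared items (same terms, `Iff.rfl`), that the split loses nothing (`moebiusLimit_iff_children`), and that on this route the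
first child reduces further to `ClusterSetTotallyDisconnected` (item stmt-4659) given the route's own `DimensionPinned`
(item stmt-4662), via `CoerciveSharpnessMoebiusLimitSplit.twoPointDoubling_of_dimensionPinned` (p150509) and
`crux_iff_doubling_and_totallyDisconnected` (p139907).

Reference: H. Duminil-Copin, *100 years of the (critical) Ising model on the hypercubic lattice*, Proc. ICM 2022, §8.4 p. 29
(existence and conformal covariance of the scaling limit open on `ℤ³`). No definitions, no `sorry`.
-/

open Summit.CriticalPhenomena.Ising3DConformalLimit.Theses

namespace Summit.CriticalPhenomena.Ising3DConformalLimit.CoerciveSharpnessMoebiusLimitOfSubs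

/-- **GLUE ITEM stmt-CriticalPhenomena-19104, by name**: the two children of the registered split give the parent
`CoerciveSharpness.MoebiusLimit`. [cite: DuminilCopinICM2022, §8.4 p. 29] -/
theorem moebiusLimitOfSubs : CoerciveSharpness.MoebiusLimitOfSubs :=
  fun h1981 h1982 => MoebiusLimitExistsTwoLeaf.coerciveSharpness_MoebiusLimit_of_leaves h1981 h1982

/-- Arrow form of the glue over the route-file children. [cite: DuminilCopinICM2022, §8.4 p. 29] -/
theorem moebiusLimit_of_children
    (h1981 : CoerciveSharpness.ExistsScaleCovariantLimit)
    (h1982 : CoerciveSharpness.InversionUpgradeNormalised) :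
    CoerciveSharpness.MoebiusLimit :=
  moebiusLimitOfSubs h1981 h1982

/-- Child 1 of the split is item stmt-1981 verbatim (one term). [cite: DuminilCopinICM2022, §8.4 p. 29] -/
theorem existsScaleCovariantLimit_iff_item1981 :
    CoerciveSharpness.ExistsScaleCovariantLimit ↔ HyperoctahedralRP.ExistsScaleCovariantLimit :=
  Iff.rfl

/-- Child 2 of the split is item stmt-1982 verbatim (one term). [cite: DuminilCopinICM2022, §8.4 p. 29] -/
theorem inversionUpgradeNormalised_iff_item1982 :
    CoerciveSharpness.InversionUpgradeNormalised ↔ HyperoctahedralRP.InversionUpgradeNormalised :=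
  Iff.rfl

/-- **The split loses nothing**: `MoebiusLimit ⟺ ExistsScaleCovariantLimit ∧ InversionUpgradeNormalised` in the route's own
spelling (each child is necessary). [cite: DuminilCopinICM2022, §8.4 p. 29] -/
theorem moebiusLimit_iff_children :
    CoerciveSharpness.MoebiusLimit ↔
      CoerciveSharpness.ExistsScaleCovariantLimit ∧ CoerciveSharpness.InversionUpgradeNormalised :=
  MoebiusLimitExistsTwoLeaf.coerciveSharpness_MoebiusLimit_iff_leaves

/-- Necessity of child 1. [cite: DuminilCopinICM2022, §8.4 p. 29] -/
theorem existsScaleCovariantLimit_of_moebiusLimit (h : CoerciveSharpness.MoebiusLimit) :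
    CoerciveSharpness.ExistsScaleCovariantLimit :=
  (moebiusLimit_iff_children.mp h).1

/-- Necessity of child 2. [cite: DuminilCopinICM2022, §8.4 p. 29] -/
theorem inversionUpgradeNormalised_of_moebiusLimit (h : CoerciveSharpness.MoebiusLimit) :
    CoerciveSharpness.InversionUpgradeNormalised :=
  (moebiusLimit_iff_children.mp h).2

/-- **On this route child 1 reduces to the cluster-set leaf**: the route's own item `DimensionPinned` (stmt-4662) gives
all-scale axial doubling (item stmt-6150), and doubling with `ClusterSetTotallyDisconnected` (item stmt-4659) is existence
(p139907). [cite: DuminilCopinICM2022, §4.2.1 p. 12] -/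
theorem existsScaleCovariantLimit_of_dimensionPinned
    (h4662 : CoerciveSharpness.DimensionPinned)
    (h4659 : ClusterRigidity.ClusterSetTotallyDisconnected) :
    CoerciveSharpness.ExistsScaleCovariantLimit :=
  Cruxes.ExistsScaleCovariantLimit.FoldedCurrentRepulsion.crux_iff_doubling_and_totallyDisconnected.mpr
    ⟨CoerciveSharpnessMoebiusLimitSplit.twoPointDoubling_of_dimensionPinned h4662, h4659⟩

/-- Hence, given `DimensionPinned`, the parent crux of this route is `ClusterSetTotallyDisconnected ∧ InversionUpgradeNormalised`
(the two genuinely residual leaves). [cite: DuminilCopinICM2022, §8.4 p. 29] -/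
theorem moebiusLimit_iff_residual_of_dimensionPinned (h4662 : CoerciveSharpness.DimensionPinned) :
    CoerciveSharpness.MoebiusLimit ↔
      ClusterRigidity.ClusterSetTotallyDisconnected ∧ CoerciveSharpness.InversionUpgradeNormalised :=
  ⟨fun h => ⟨CoerciveSharpnessMoebiusLimitSplit.clusterSetTotallyDisconnected_of_MoebiusLimit h,
      inversionUpgradeNormalised_of_moebiusLimit h⟩,
    fun h => moebiusLimit_of_children (existsScaleCovariantLimit_of_dimensionPinned h4662 h.1) h.2⟩

end Summit.CriticalPhenomena.Ising3DConformalLimit.CoerciveSharpnessMoebiusLimitOfSubs
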